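import Literature.NumberTheory.Automorphic.RestrictedTensorProductCoinvariants
import Literature.NumberTheory.Automorphic.RestrictedTensorProductIrreducibleProofs
import Literature.NumberTheory.Automorphic.FiniteAdeleWeilAssembly
import HarnessLib

/-!
# Coinvariants of a restricted tensor product representation under a central restricted sub-family,
# and the `⊗'` clause of [Liu2021, Def. 4.11] for the place-assembled finite Weil representation

Topic `NumberTheory/Automorphic`.  Continuation of `RestrictedTensorProductCoinvariants.lean`
(`IsRestrictedTensorProductRep.coinv`: «`Coinv_{∏'_v H_v, ⊗χ_v} (⊗'_v S_v) ≅ ⊗'_v Coinv_{H_v, χ_v} (S_v)` as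
`∏'_v G_v`-modules» for a dual pair acting slot by slot) in the shape in which the Hodge/CM cell and
[Liu2021, Def. 4.11 + App. D §D.1 Step 3] meet it: ONE restricted tensor product representation `π = ⊗'_v ρ_v` of
`Πʳ_v [G_v, K_v]` on a model `(W, j)`, RESTRICTED along a restricted product of local homomorphisms
`φ_v : H_v →* G_v` (`φ_v(KH_v) ⊆ K_v` for almost all `v`; Mathlib `RestrictedProduct.mapAlongMonoidHom`, the tree's
`piLocalHom`) whose images are CENTRAL — e.g. the centre `E_v¹ ↪ U(V)(F_v)` of a unitary group, or the second member
of a unitary dual pair seen through a local splitting.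

## What is proved (theorems only; no definition, no record, no named fact)

§1 (any commutative ring of scalars)
* `Representation.eventually_mem_fixedPoints_comp` — base vectors stay `KH_v`-fixed under `ρ_v ∘ φ_v`;
* `IsRestrictedTensorProductRep.comp` — **restriction along slotwise homomorphisms**: if `(W, π, j)` is
  `⊗'_v (ρ_v, x₀_v)` then `(W, π ∘ Πʳφ, j)` is `⊗'_v (ρ_v ∘ φ_v, x₀_v)` (same exceptional set);

§2 (field of scalars)
* `IsRestrictedTensorProductRep.isRestrictedTensorProduct_centralCoinv` — the `χ`-coinvariants of `π ∘ Πʳφ`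
  (`χ = ∏_v χ_v`, `χ_v` trivial on `KH_v` for almost all `v`), with ANY comparison map `J`, `J([x_v])_v = [j x]`
  (`exists_coinvMap`), are `⊗'_v Coinv(ρ_v ∘ φ_v, χ_v)` as MODULES, exceptional set any finite `S₁` off which
  `[x₀_v] ≠ 0`;
* `IsRestrictedTensorProductRep.centralCoinv` — **the same AS REPRESENTATIONS of `Πʳ_v [G_v, K_v]`** whenever the
  restricted operators commute with the original ones (`hc`, `hcomm`: automatic for `φ_v` of central image, by `map_mul`):
  `IsRestrictedTensorProductRep (v ↦ TwistedCoinv.rep χ_v ρ_v (hc v)) (TwistedCoinv.rep χ π hcomm) _ J S₁`;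
* `IsRestrictedTensorProductRep.nontrivial_centralCoinv` — hence `Coinv(π ∘ Πʳφ, χ) ≠ 0` as soon as the local
  quotients at the places of `S₁` are non-zero (the tree's `IsRestrictedTensorProduct.nontrivial`).

§3 (the Weil instance) For the tree's place-assembled finite-adelic representation
`finiteAdeleRep K ι r hK = ⊗'_v r_v` on `𝒮((𝔸_{K,f})^ι)` (`FiniteAdeleWeilAssembly`, certificate
`isRestrictedTensorProductRep_finiteAdeleRep`, exceptional set `∅`) and in particular for the finite Weil
representation `Ω = ⊗'_v ω_v` of a unitary group assembled from a family of LOCAL splittings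
(`GelbartRogawski1991.UnitaryDualPair.LocalSplitting.FinLocalSplittings.OmegaPi`, [GelbartRogawski1991, §3.1
Prop. 3.1.1 p. 455 lines 1–3]; Liu's `ι_{μ_v}`, [Liu2021, App. D §D.1 Step 1]):
`finiteAdeleRep_centralCoinv` (+ `_nontrivial`) here, and `FinLocalSplittings.omegaPi_centralCoinv` (+ `_nontrivial`) in the
sibling `GelbartRogawski1991/FiniteAdelicWeilCentralCoinvariants.lean` — **the coinvariants of `Ω ∘ Πʳφ` at `χ = ∏_v χ_v`
ARE `⊗'_v Coinv(ω_v ∘ φ_v, χ_v)` as `Πʳ_v [U(J)(F_v), U(J)(𝒪_v)]`-representations.**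
With `φ_v` the local centre this is, token for token, [Liu2021, Def. 4.11] (FJcycle.tex l. 2092–2096)
«`ω(μ, ε, χ) := ⊗'_v ω(μ_v, ε_v, χ_v)`» for `ω(μ_v, ε_v, χ_v) :=` «the maximal quotient of `ω(μ_v, ε_v)` on which the
centre acts by `χ_v`» ([Liu2021, App. D §D.1 Step 3], l. 5218–5223) — as a KERNEL CERTIFICATE on the tree's own Weil
carrier, whose displayed local input is the survival of the unramified vector `[1_{𝒪_v^ι}] ≠ 0` off `S₁`
(Def. 4.11 «unramified for all but finitely many `v`»; the tree's `Liu2021/LemD1AsPrinted.lean`,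
`AdelicOscillatorNonvanishingAsPrinted.lean`), and whose `Nontrivial` corollary is the `hj`-input of
`Liu2021.Thm418Data.nontrivial_omega_of_localOscillator` (`AdelicOscillatorNonvanishing.lean`).

NOT here (honest scope): the comparison of the place-assembled `Ω ∘ Πʳφ` with the Weil representation through an
ABSTRACT compatible adelic splitting (`UnitaryDualPair.WeilCoinv.finPairRepW` of a `CompatibleSplitting` witness) —
that is a central-twist statement (`SplittingDatum.IsCompatible.exists_central_twist`, under its `hker`) and lives
with `UnitaryDualPairWeilCoinvariantsTwist.lean` / `RepresentationTheory/TwistedCoinvariantsVanishing.lean`.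

## References
* [Flath1979] D. Flath, *Decomposition of representations into tensor products*, PSPM 33 (1979) part 1, §2, Example 2.
* [BernsteinZelevinskyASENS1977] I. N. Bernstein, A. V. Zelevinsky, Ann. Sci. ÉNS 10 (1977), §4.7 (right exactness).
* [Liu2021] Y. Liu, *Fourier–Jacobi cycles and arithmetic relative trace formula*, Camb. J. Math. 9 (2021) =
  arXiv:2102.11518: Def. 4.11 (l. 2083–2097), App. D §D.1 Steps 1–3 (l. 5214–5223), Lem. D.1 (1) (l. 5226–5229).
* [GelbartRogawski1991] S. Gelbart, J. Rogawski, Invent. Math. 105 (1991), §3.1 Prop. 3.1.1 p. 455.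
* [MoeglinVignerasWaldspurger1987] C. Mœglin, M.-F. Vignéras, J.-L. Waldspurger, LNM 1291, Chap. 2 II.1, Chap. 3 IV.
-/

noncomputable section

open scoped RestrictedProduct
open Filter Function Set IsDedekindDomain NumberField
open Literature.RepresentationTheory

namespace Literature.NumberTheory.Automorphic

universe u uk uG uH v w

/-! ### §1 Restriction of a restricted tensor product representation along slotwise homomorphisms -/

section Comp

variable {ι : Type u} {k : Type uk} [CommRing k] {G : ι → Type uG} [∀ i, Group (G i)]
  {K : ∀ i, Subgroup (G i)} {H : ι → Type uH} [∀ i, Group (H i)] {KH : ∀ i, Subgroup (H i)}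
  {V : ι → Type v} [∀ i, AddCommGroup (V i)] [∀ i, Module k (V i)]
  {ρ : ∀ i, Representation k (G i) (V i)} {x₀ : ∀ i, V i}
  {W : Type w} [AddCommGroup W] [Module k W] {j : RestrictedFamily V x₀ → W} {S₀ : Finset ι}
  {hx₀ : ∀ᶠ i in cofinite, x₀ i ∈ (ρ i).fixedPoints (K i)}
  {π : Representation k (Πʳ i, [G i, K i]) W}

/-- Base vectors fixed by `K_v` under `ρ_v` stay fixed by `KH_v` under `ρ_v ∘ φ_v` whenever `φ_v(KH_v) ⊆ K_v`, for
almost all `v` (the hypothesis under which `Πʳ_v [H_v, KH_v]` acts on restricted families through the restricted local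
representations). [cite: Flath1979, §2  Example 2] -/
theorem Representation.eventually_mem_fixedPoints_comp (φ : ∀ i, H i →* G i)
    (hx₀ : ∀ᶠ i in cofinite, x₀ i ∈ (ρ i).fixedPoints (K i))
    (hφ : ∀ᶠ i in cofinite, MapsTo (φ i) (KH i) (K i)) :
    ∀ᶠ i in cofinite, x₀ i ∈
      Representation.fixedPoints (k := k) (G := H i) ((ρ i).comp (φ i)) (KH i) :=
  (hx₀.and hφ).mono fun i hi =>
    (Representation.mem_fixedPoints _ (KH i) _).2 fun h hh => by
      rw [MonoidHom.comp_apply]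
      exact (Representation.mem_fixedPoints _ (K i) _).1 hi.1 (φ i h) (hi.2 hh)

variable [DecidableEq ι]

/-- **Restriction along slotwise homomorphisms.**  If `(W, π, j)` is a restricted tensor product `⊗'_v (ρ_v, x₀_v)`
of representations of `Πʳ_v [G_v, K_v]` and `φ_v : H_v →* G_v` map `KH_v` into `K_v` for almost all `v`, then
`(W, π ∘ Πʳφ, j)` is the restricted tensor product `⊗'_v (ρ_v ∘ φ_v, x₀_v)` of the restricted local representations,
with the same exceptional set (`Πʳφ` = Mathlib's `RestrictedProduct.mapAlongMonoidHom` along `id`, the tree's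
`piLocalHom`). [cite: Flath1979, §2  Example 2] -/
theorem IsRestrictedTensorProductRep.comp (h : IsRestrictedTensorProductRep ρ π hx₀ j S₀) (φ : ∀ i, H i →* G i)
    (hφ : ∀ᶠ i in cofinite, MapsTo (φ i) (KH i) (K i)) :
    IsRestrictedTensorProductRep (K := KH) (fun i => show Representation k (H i) (V i) from (ρ i).comp (φ i))
      (π.comp (RestrictedProduct.mapAlongMonoidHom H G id Filter.tendsto_id φ hφ))
      (Representation.eventually_mem_fixedPoints_comp φ hx₀ hφ) j S₀ := by
  refine ⟨h.isRestrictedTensorProduct, fun g x => ?_⟩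
  have e : RestrictedFamily.smul (K := KH) (fun i => show Representation k (H i) (V i) from (ρ i).comp (φ i))
      (Representation.eventually_mem_fixedPoints_comp φ hx₀ hφ) g x =
      RestrictedFamily.smul ρ hx₀ (RestrictedProduct.mapAlongMonoidHom H G id Filter.tendsto_id φ hφ g) x := by
    ext i
    rfl
  rw [e, h.map_smul]
  rfl

end Comp

/-! ### §2 Central coinvariants over a field -/

section Central

variable {ι : Type u} {k : Type uk} [Field k] {G : ι → Type uG} [∀ i, Group (G i)]
  {K : ∀ i, Subgroup (G i)} {H : ι → Type uH} [∀ i, Group (H i)] {KH : ∀ i, Subgroup (H i)}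
  {V : ι → Type v} [∀ i, AddCommGroup (V i)] [∀ i, Module k (V i)]
  {ρ : ∀ i, Representation k (G i) (V i)} {x₀ : ∀ i, V i} [DecidableEq ι]
  {W : Type w} [AddCommGroup W] [Module k W] {j : RestrictedFamily V x₀ → W} {S₀ : Finset ι}
  {hx₀ : ∀ᶠ i in cofinite, x₀ i ∈ (ρ i).fixedPoints (K i)}
  {π : Representation k (Πʳ i, [G i, K i]) W}
  {φ : ∀ i, H i →* G i} {hφ : ∀ᶠ i in cofinite, MapsTo (φ i) (KH i) (K i)}
  {χloc : ∀ i, H i →* kˣ}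
  {hq : ∀ᶠ i in cofinite,
    TwistedCoinv.mk (show Representation k (H i) (V i) from (ρ i).comp (φ i)) (χloc i) (x₀ i) =
      TwistedCoinv.mk (show Representation k (H i) (V i) from (ρ i).comp (φ i)) (χloc i) (x₀ i)}

omit [DecidableEq ι] in
/-- A restricted tensor product whose factors at the exceptional places are non-zero is non-zero (private copy of
`IsRestrictedTensorProduct.nontrivial` of `Liu2021/AdelicOscillatorNonvanishing.lean`, kept here to avoid importing the
Liu records into this generic file: `⨂_{i ∈ S₀} V i ≠ 0` embeds by `injective_liftFinset`). [cite: Flath1979, §2] -/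
private theorem IsRestrictedTensorProduct.nontrivial_of_exceptional [DecidableEq ι] {V' : ι → Type v}
    [∀ i, AddCommGroup (V' i)] [∀ i, Module k (V' i)] {x₀' : ∀ i, V' i} {W' : Type w} [AddCommGroup W']
    [Module k W'] {j' : RestrictedFamily V' x₀' → W'} {S : Finset ι} (h : IsRestrictedTensorProduct k j' S)
    (hV : ∀ i ∈ S, Nontrivial (V' i)) : Nontrivial W' := by
  haveI : ∀ i : S, Nontrivial (V' i) := fun i => hV i i.2
  haveI : Nontrivial (PiTensorProduct k fun i : S => V' i) := piTensorProduct_nontrivial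
  exact (h.injective_liftFinset (Finset.Subset.refl S)).nontrivial

/-- **Coinvariants under a restricted sub-family are `⊗'` of the local coinvariants (modules).**  For
`(W, π, j) = ⊗'_v (ρ_v, x₀_v)`, homomorphisms `φ_v : H_v →* G_v` (`φ_v(KH_v) ⊆ K_v` a.e.), local characters `χ_v`
trivial on `KH_v` for almost all `v`, the global character `χ = ∏_v χ_v` of `Πʳ_v [H_v, KH_v]`, and any comparison map
`J` with `J([x_v])_v = [j x]`: `(Coinv(π ∘ Πʳφ, χ), J)` is a restricted tensor product of the local coinvariants
`(Coinv(ρ_v ∘ φ_v, χ_v), [x₀_v])`, with exceptional set any finite `S₁` off which `[x₀_v] ≠ 0`.  (`comp` followed by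
the tree's `isRestrictedTensorProduct_coinv`; centrality is not needed for the module statement.)
[cite: Flath1979, §2  Example 2] -/
theorem IsRestrictedTensorProductRep.isRestrictedTensorProduct_centralCoinv
    (h : IsRestrictedTensorProductRep ρ π hx₀ j S₀) (χ : (Πʳ i, [H i, KH i]) →* kˣ)
    (hχ : ∀ g : Πʳ i, [H i, KH i], ((χ g : kˣ) : k) = ∏ᶠ i, ((χloc i (g i) : kˣ) : k))
    (hχK : ∀ᶠ i in cofinite, ∀ g ∈ KH i, χloc i g = 1)
    {S₁ : Finset ι}
    (hx₀N : ∀ i ∉ S₁,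
      TwistedCoinv.mk (show Representation k (H i) (V i) from (ρ i).comp (φ i)) (χloc i) (x₀ i) ≠ 0)
    (J : RestrictedFamily
        (fun i => TwistedCoinv.Coinv (show Representation k (H i) (V i) from (ρ i).comp (φ i)) (χloc i))
        (fun i => TwistedCoinv.mk (show Representation k (H i) (V i) from (ρ i).comp (φ i)) (χloc i) (x₀ i)) →
      TwistedCoinv.Coinv (π.comp (RestrictedProduct.mapAlongMonoidHom H G id Filter.tendsto_id φ hφ)) χ)
    (hJ : ∀ x : RestrictedFamily V x₀,
      J (RestrictedFamily.piMap
          (x₀' := fun i =>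
            TwistedCoinv.mk (show Representation k (H i) (V i) from (ρ i).comp (φ i)) (χloc i) (x₀ i))
          (fun i => TwistedCoinv.mk (show Representation k (H i) (V i) from (ρ i).comp (φ i)) (χloc i)) hq x) =
        TwistedCoinv.mk (π.comp (RestrictedProduct.mapAlongMonoidHom H G id Filter.tendsto_id φ hφ)) χ (j x)) :
    IsRestrictedTensorProduct k J S₁ :=
  (h.comp φ hφ).isRestrictedTensorProduct_coinv χ hχ hχK hx₀N J hJ

/-- **Central coinvariants of a restricted tensor product representation are `⊗'` of the local central
coinvariants, AS REPRESENTATIONS.**  When the operators `ρ_v(φ_v h)` commute with the `ρ_v(g)` (`hc`; e.g. `φ_v` of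
CENTRAL image: `ρ_v(g) ρ_v(φ_v h) = ρ_v(g · φ_v h) = ρ_v(φ_v h · g)`) and likewise globally (`hcomm`, the same computation in
`Πʳ_v [G_v, K_v]`), the `χ = ∏_v χ_v`-coinvariants of `π ∘ Πʳφ` carry the induced action `TwistedCoinv.rep χ π hcomm` of
`Πʳ_v [G_v, K_v]`, the local quotients carry `TwistedCoinv.rep χ_v ρ_v (hc v)`, and
`(Coinv(π ∘ Πʳφ, χ), TwistedCoinv.rep χ π hcomm, J)` IS `⊗'_v (TwistedCoinv.rep χ_v ρ_v (hc v), [x₀_v])` (tree predicate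
`IsRestrictedTensorProductRep`; exceptional set any finite `S₁` off which `[x₀_v] ≠ 0`; `hc`, `hcomm` and the fixed-vector
input `hx₀'` are ARBITRARY proofs — `hx₀'` is supplied by the tree's `IsRestrictedTensorProductRep.eventually_mk_mem_fixedPoints`).
This is «the maximal quotient on which the centre acts by `χ = ⊗χ_v`» `=` «`⊗'_v` (the maximal quotient on which the local
centre acts by `χ_v`)». [cite: Flath1979, §2  Example 2] -/
theorem IsRestrictedTensorProductRep.centralCoinv
    (h : IsRestrictedTensorProductRep ρ π hx₀ j S₀)
    (hc : ∀ (i : ι) (g : G i) (h' : H i),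
      Commute (ρ i g) ((show Representation k (H i) (V i) from (ρ i).comp (φ i)) h'))
    (hcomm : ∀ (g : Πʳ i, [G i, K i]) (h' : Πʳ i, [H i, KH i]),
      Commute (π g) ((π.comp (RestrictedProduct.mapAlongMonoidHom H G id Filter.tendsto_id φ hφ)) h'))
    (χ : (Πʳ i, [H i, KH i]) →* kˣ)
    (hχ : ∀ g : Πʳ i, [H i, KH i], ((χ g : kˣ) : k) = ∏ᶠ i, ((χloc i (g i) : kˣ) : k))
    (hχK : ∀ᶠ i in cofinite, ∀ g ∈ KH i, χloc i g = 1)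
    {S₁ : Finset ι}
    (hx₀N : ∀ i ∉ S₁,
      TwistedCoinv.mk (show Representation k (H i) (V i) from (ρ i).comp (φ i)) (χloc i) (x₀ i) ≠ 0)
    (hx₀' : ∀ᶠ i in cofinite, TwistedCoinv.mk (show Representation k (H i) (V i) from (ρ i).comp (φ i)) (χloc i) (x₀ i) ∈
      (TwistedCoinv.rep (χloc i) (ρ i) (hc i)).fixedPoints (K i))
    (J : RestrictedFamily
        (fun i => TwistedCoinv.Coinv (show Representation k (H i) (V i) from (ρ i).comp (φ i)) (χloc i))
        (fun i => TwistedCoinv.mk (show Representation k (H i) (V i) from (ρ i).comp (φ i)) (χloc i) (x₀ i)) →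
      TwistedCoinv.Coinv (π.comp (RestrictedProduct.mapAlongMonoidHom H G id Filter.tendsto_id φ hφ)) χ)
    (hJ : ∀ x : RestrictedFamily V x₀,
      J (RestrictedFamily.piMap
          (x₀' := fun i =>
            TwistedCoinv.mk (show Representation k (H i) (V i) from (ρ i).comp (φ i)) (χloc i) (x₀ i))
          (fun i => TwistedCoinv.mk (show Representation k (H i) (V i) from (ρ i).comp (φ i)) (χloc i)) hq x) =
        TwistedCoinv.mk (π.comp (RestrictedProduct.mapAlongMonoidHom H G id Filter.tendsto_id φ hφ)) χ (j x)) :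
    IsRestrictedTensorProductRep (fun i => TwistedCoinv.rep (χloc i) (ρ i) (hc i)) (TwistedCoinv.rep χ π hcomm) hx₀'
      J S₁ :=
  h.coinv (h.comp φ hφ) hc hcomm χ hχ hχK hx₀N hx₀' J hJ

/-- **Non-vanishing of the central coinvariants from the local quotients**: under the hypotheses of
`centralCoinv` (only the module statement is used), if the local quotients `Coinv(ρ_v ∘ φ_v, χ_v)` are non-zero at
the places of `S₁` then `Coinv(π ∘ Πʳφ, χ) ≠ 0`.  The local input at the places off `S₁` is `[x₀_v] ≠ 0`
(`hx₀N`), which already makes those quotients non-zero. [cite: Flath1979, §2] -/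
theorem IsRestrictedTensorProductRep.nontrivial_centralCoinv
    (h : IsRestrictedTensorProductRep ρ π hx₀ j S₀) (χ : (Πʳ i, [H i, KH i]) →* kˣ)
    (hχ : ∀ g : Πʳ i, [H i, KH i], ((χ g : kˣ) : k) = ∏ᶠ i, ((χloc i (g i) : kˣ) : k))
    (hχK : ∀ᶠ i in cofinite, ∀ g ∈ KH i, χloc i g = 1)
    {S₁ : Finset ι}
    (hx₀N : ∀ i ∉ S₁,
      TwistedCoinv.mk (show Representation k (H i) (V i) from (ρ i).comp (φ i)) (χloc i) (x₀ i) ≠ 0)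
    (hS₁ : ∀ i ∈ S₁,
      Nontrivial (TwistedCoinv.Coinv (show Representation k (H i) (V i) from (ρ i).comp (φ i)) (χloc i)))
    (J : RestrictedFamily
        (fun i => TwistedCoinv.Coinv (show Representation k (H i) (V i) from (ρ i).comp (φ i)) (χloc i))
        (fun i => TwistedCoinv.mk (show Representation k (H i) (V i) from (ρ i).comp (φ i)) (χloc i) (x₀ i)) →
      TwistedCoinv.Coinv (π.comp (RestrictedProduct.mapAlongMonoidHom H G id Filter.tendsto_id φ hφ)) χ)
    (hJ : ∀ x : RestrictedFamily V x₀,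
      J (RestrictedFamily.piMap
          (x₀' := fun i =>
            TwistedCoinv.mk (show Representation k (H i) (V i) from (ρ i).comp (φ i)) (χloc i) (x₀ i))
          (fun i => TwistedCoinv.mk (show Representation k (H i) (V i) from (ρ i).comp (φ i)) (χloc i)) hq x) =
        TwistedCoinv.mk (π.comp (RestrictedProduct.mapAlongMonoidHom H G id Filter.tendsto_id φ hφ)) χ (j x)) :
    Nontrivial (TwistedCoinv.Coinv (π.comp (RestrictedProduct.mapAlongMonoidHom H G id Filter.tendsto_id φ hφ)) χ) :=
  (h.isRestrictedTensorProduct_centralCoinv χ hχ hχK hx₀N J hJ).nontrivial_of_exceptional hS₁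

/-- **The comparison map exists** (re-export of `exists_coinvMap` for the restricted representation, so that the
three theorems above are never vacuous in `J`). [cite: Flath1979, §2  Example 2] -/
theorem IsRestrictedTensorProductRep.exists_centralCoinvMap
    (h : IsRestrictedTensorProductRep ρ π hx₀ j S₀) (χ : (Πʳ i, [H i, KH i]) →* kˣ)
    (hχ : ∀ g : Πʳ i, [H i, KH i], ((χ g : kˣ) : k) = ∏ᶠ i, ((χloc i (g i) : kˣ) : k)) :
    ∃ J : RestrictedFamily
        (fun i => TwistedCoinv.Coinv (show Representation k (H i) (V i) from (ρ i).comp (φ i)) (χloc i))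
        (fun i => TwistedCoinv.mk (show Representation k (H i) (V i) from (ρ i).comp (φ i)) (χloc i) (x₀ i)) →
      TwistedCoinv.Coinv (π.comp (RestrictedProduct.mapAlongMonoidHom H G id Filter.tendsto_id φ hφ)) χ,
      ∀ x : RestrictedFamily V x₀,
        J (RestrictedFamily.piMap
            (x₀' := fun i =>
              TwistedCoinv.mk (show Representation k (H i) (V i) from (ρ i).comp (φ i)) (χloc i) (x₀ i))
            (fun i => TwistedCoinv.mk (show Representation k (H i) (V i) from (ρ i).comp (φ i)) (χloc i)) hq x) =
          TwistedCoinv.mk (π.comp (RestrictedProduct.mapAlongMonoidHom H G id Filter.tendsto_id φ hφ)) χ (j x) :=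
  (h.comp φ hφ).exists_coinvMap χloc χ hχ hq

end Central

/-! ### §3 The Weil instance: the place-assembled finite-adelic representation and [Liu2021, Def. 4.11] -/

section Weil

variable (K : Type) [Field K] [NumberField K] (ι : Type) [Fintype ι] [DecidableEq (HeightOneSpectrum (𝓞 K))]
  {G : HeightOneSpectrum (𝓞 K) → Type uG} [∀ v, Group (G v)] {Kc : ∀ v, Subgroup (G v)}
  (r : ∀ v, Representation ℂ (G v) ↥(SchwartzBruhat (ι → v.adicCompletion K)))
  (hK : ∀ᶠ v in cofinite, unitVec K ι v ∈ (r v).fixedPoints (Kc v))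
  {H : HeightOneSpectrum (𝓞 K) → Type uH} [∀ v, Group (H v)] {KH : ∀ v, Subgroup (H v)}
  (φ : ∀ v, H v →* G v) (hφ : ∀ᶠ v in cofinite, MapsTo (φ v) (KH v) (Kc v))
  {χloc : ∀ v, H v →* ℂˣ}
  {hq : ∀ᶠ v in cofinite,
    TwistedCoinv.mk (show Representation ℂ (H v) _ from (r v).comp (φ v)) (χloc v) (unitVec K ι v) =
      TwistedCoinv.mk (show Representation ℂ (H v) _ from (r v).comp (φ v)) (χloc v) (unitVec K ι v)}

/-- **`Coinv(⊗'_v r_v ∘ Πʳφ, ∏χ_v) = ⊗'_v Coinv(r_v ∘ φ_v, χ_v)` on `𝒮((𝔸_{K,f})^ι)`**, as representations of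
`Πʳ_v [G_v, Kc_v]`, for the tree's place-assembled `finiteAdeleRep K ι r hK` restricted along local homomorphisms `φ_v`
whose operators commute with the `r_v(g)` (`hc`, `hcomm`; e.g. `φ_v` of central image) — `centralCoinv` at the certificate
`isRestrictedTensorProductRep_finiteAdeleRep`. [cite: Flath1979, §2  Example 2] -/
theorem finiteAdeleRep_centralCoinv
    (hc : ∀ (v : HeightOneSpectrum (𝓞 K)) (g : G v) (h' : H v),
      Commute (r v g) ((show Representation ℂ (H v) _ from (r v).comp (φ v)) h'))
    (hcomm : ∀ (g : Πʳ v, [G v, Kc v]) (h' : Πʳ v, [H v, KH v]),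
      Commute (finiteAdeleRep K ι r hK g)
        (((finiteAdeleRep K ι r hK).comp (RestrictedProduct.mapAlongMonoidHom H G id Filter.tendsto_id φ hφ)) h'))
    (χ : (Πʳ v, [H v, KH v]) →* ℂˣ)
    (hχ : ∀ g : Πʳ v, [H v, KH v], ((χ g : ℂˣ) : ℂ) = ∏ᶠ v, ((χloc v (g v) : ℂˣ) : ℂ))
    (hχK : ∀ᶠ v in cofinite, ∀ g ∈ KH v, χloc v g = 1)
    {S₁ : Finset (HeightOneSpectrum (𝓞 K))}
    (hx₀N : ∀ v ∉ S₁,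
      TwistedCoinv.mk (show Representation ℂ (H v) _ from (r v).comp (φ v)) (χloc v) (unitVec K ι v) ≠ 0)
    (hx₀' : ∀ᶠ v in cofinite,
      TwistedCoinv.mk (show Representation ℂ (H v) _ from (r v).comp (φ v)) (χloc v) (unitVec K ι v) ∈
        (TwistedCoinv.rep (χloc v) (r v) (hc v)).fixedPoints (Kc v))
    (J : RestrictedFamily
        (fun v => TwistedCoinv.Coinv (show Representation ℂ (H v) _ from (r v).comp (φ v)) (χloc v))
        (fun v => TwistedCoinv.mk (show Representation ℂ (H v) _ from (r v).comp (φ v)) (χloc v) (unitVec K ι v)) →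
      TwistedCoinv.Coinv
        ((finiteAdeleRep K ι r hK).comp (RestrictedProduct.mapAlongMonoidHom H G id Filter.tendsto_id φ hφ)) χ)
    (hJ : ∀ x : LocalSBFamily K ι,
      J (RestrictedFamily.piMap
          (x₀' := fun v =>
            TwistedCoinv.mk (show Representation ℂ (H v) _ from (r v).comp (φ v)) (χloc v) (unitVec K ι v))
          (fun v => TwistedCoinv.mk (show Representation ℂ (H v) _ from (r v).comp (φ v)) (χloc v)) hq x) =
        TwistedCoinv.mk
          ((finiteAdeleRep K ι r hK).comp (RestrictedProduct.mapAlongMonoidHom H G id Filter.tendsto_id φ hφ)) χ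
          (piProdSB K ι x)) :
    IsRestrictedTensorProductRep (fun v => TwistedCoinv.rep (χloc v) (r v) (hc v))
      (TwistedCoinv.rep χ (finiteAdeleRep K ι r hK) hcomm) hx₀' J S₁ :=
  (isRestrictedTensorProductRep_finiteAdeleRep K ι r hK).centralCoinv hc hcomm χ hχ hχK hx₀N hx₀' J hJ

/-- and its non-vanishing corollary: `Coinv(⊗'_v r_v ∘ Πʳφ, ∏χ_v) ≠ 0` as soon as the local quotients at the places
of `S₁` are non-zero. [cite: Flath1979, §2] -/
theorem finiteAdeleRep_centralCoinv_nontrivial (χ : (Πʳ v, [H v, KH v]) →* ℂˣ)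
    (hχ : ∀ g : Πʳ v, [H v, KH v], ((χ g : ℂˣ) : ℂ) = ∏ᶠ v, ((χloc v (g v) : ℂˣ) : ℂ))
    (hχK : ∀ᶠ v in cofinite, ∀ g ∈ KH v, χloc v g = 1)
    {S₁ : Finset (HeightOneSpectrum (𝓞 K))}
    (hx₀N : ∀ v ∉ S₁,
      TwistedCoinv.mk (show Representation ℂ (H v) _ from (r v).comp (φ v)) (χloc v) (unitVec K ι v) ≠ 0)
    (hS₁ : ∀ v ∈ S₁,
      Nontrivial (TwistedCoinv.Coinv (show Representation ℂ (H v) _ from (r v).comp (φ v)) (χloc v)))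
    (J : RestrictedFamily
        (fun v => TwistedCoinv.Coinv (show Representation ℂ (H v) _ from (r v).comp (φ v)) (χloc v))
        (fun v => TwistedCoinv.mk (show Representation ℂ (H v) _ from (r v).comp (φ v)) (χloc v) (unitVec K ι v)) →
      TwistedCoinv.Coinv
        ((finiteAdeleRep K ι r hK).comp (RestrictedProduct.mapAlongMonoidHom H G id Filter.tendsto_id φ hφ)) χ)
    (hJ : ∀ x : LocalSBFamily K ι,
      J (RestrictedFamily.piMap
          (x₀' := fun v =>
            TwistedCoinv.mk (show Representation ℂ (H v) _ from (r v).comp (φ v)) (χloc v) (unitVec K ι v))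
          (fun v => TwistedCoinv.mk (show Representation ℂ (H v) _ from (r v).comp (φ v)) (χloc v)) hq x) =
        TwistedCoinv.mk
          ((finiteAdeleRep K ι r hK).comp (RestrictedProduct.mapAlongMonoidHom H G id Filter.tendsto_id φ hφ)) χ
          (piProdSB K ι x)) :
    Nontrivial (TwistedCoinv.Coinv
      ((finiteAdeleRep K ι r hK).comp (RestrictedProduct.mapAlongMonoidHom H G id Filter.tendsto_id φ hφ)) χ) :=
  (isRestrictedTensorProductRep_finiteAdeleRep K ι r hK).nontrivial_centralCoinv χ hχ hχK hx₀N hS₁ J hJ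

end Weil

end Literature.NumberTheory.Automorphic

end
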